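import Mathlib
import HarnessLib
import Literature.Analysis.Calculus.PlanarPolarIntegral

/-!
# Route `KLProgramme` — crux K3 split, ENGINE child (`KLRegimeEngineV7` stmt-HubbardSuperconductivity-19662 and its gen-3 successor):
# the planar momentum integral in POLAR-RAY COORDINATES ADAPTED TO THE LEVEL CURVES of the frame band — the bridge from the carrier's
# `∫ d²k` to the `(θ, e)`-integrals in which the zero-sound / thermal / transfer lemmas (`klzs_*`, `klzd_*`, `klzw_*`, `klza_*`, `klte_*`,
# `klsp_*`) are stated (cell gate-hubbard-kl, seat hubbard-kl-k3c2-p2 «thermal-bar induction n ≤ nScales β + 1»)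

WHY.  Every `(k₀, e)`-plane lemma of the (T)/zero-sound chain is stated for integrands `∫ de W(e)·[function of (k₀, e)]`, `e` the frame energy
`e_K`.  On the carrier the bubble is `∫_{[-π,π)²} d²k Φ(k) F(k₀² + e_K(k)²)/…`: one passes to polar coordinates `k = t·(cos θ, sin θ)` around
`Γ` (the Fermi sea of the window is star-shaped around `Γ`; tree: `bandFermiRadius`, `rayDispersion`, `exists_pos_le_rayDispersionDt`, p4's
`perturbedFermiRadius_frame`) and then, on each ray, to the energy variable `e = e_K(t·dir θ)` through the inverse `t = ρ(θ, e)` (Dini; BGM 2006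
(2.56b)–(2.56e), HOME/p1/E2-NOTE.md §1: Jacobian `𝒥(θ,e) = ρ·∂_eρ = ρ/∂_t e`).  This module proves the resulting identity ABSTRACTLY — for any
continuous compactly supported `h : ℝ × ℝ → E` and any family of ray reparametrisations `ρ(θ, ·)` (C¹ on `[-ē, ē]`, positive, increasing
end points) such that along each ray `h` vanishes outside `t ∈ (ρ(θ,-ē), ρ(θ,ē))`:

  `∫ h = ∫_{θ ∈ (-π,π)} ∫_{e ∈ -ē..ē} (ρ(θ,e)·∂_eρ(θ,e)) • h(ρ(θ,e) cos θ, ρ(θ,e) sin θ) de dθ`      (`klry_integral_eq_polar_ray`).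

Nothing about the band is assumed here: the step prover instantiates `ρ(θ, ·)` with the inverse of `t ↦ e_K(t·dir θ)` on the tube `|e_K| ≤ ē`
(so that `e_K(ρ(θ,e)·dir θ) = e` turns `F(k₀² + e_K²)` into `F(k₀² + e²)` and `W(e) := 𝒥(θ,e)·Φ(ρ(θ,e)·dir θ)` is the insertion of
`klte_slice_bubble_weighted_norm_le` / `klsp_slice_bubble_transfer_norm_le`).  Steps: Mathlib's polar change of variables in the iterated form of
`Literature/Analysis/Calculus/PlanarPolarIntegral` (`integrable_polar_prod`), Fubini with the angle outside (`integral_prod_symm`), restriction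
of the radial integral to the ray segment carrying the support, and the one-dimensional substitution `t = ρ(θ, e)`
(`intervalIntegral.integral_deriv_smul_comp`).  Pure analysis.
References: BGM 2006 = Benfatto–Giuliani–Mastropietro, Ann. Henri Poincaré 7 (2006) 809, §2.5 (2.56b)–(2.56e); HOME/p1/E2-NOTE.md §1, §3 STEP 0–1.
-/

noncomputable section

namespace Summit.HubbardSuperconductivity.HubbardSuperconductivity.Theorems.KLRegimeSplit

set_option linter.dupNamespace false -- summit = problem name (single-conjunct summit), D-0017

open Real Set MeasureTheory intervalIntegral Literature.Analysis.Calculus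

variable {E : Type*} [NormedAddCommGroup E] [NormedSpace ℝ E]

/-- **Polar coordinates with the angle outside**: for integrable `h : ℝ × ℝ → E`,
`∫ h = ∫_{θ ∈ (-π,π)} ∫_{t > 0} t • h(t cos θ, t sin θ) dt dθ`. -/
theorem klry_integral_eq_integral_Ioo_integral_Ioi_polar {h : ℝ × ℝ → E} (hint : Integrable h) :
    ∫ p, h p = ∫ θ in Ioo (-π) π, ∫ t in Ioi (0 : ℝ), t • h (t * Real.cos θ, t * Real.sin θ) := by
  rw [← integral_comp_polarCoord_symm h, volume_restrict_polarCoord_target]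
  simp only [polarCoord_symm_apply]
  rw [integral_prod_symm _ (integrable_polar_prod hint)]

/-- **One ray**: if `t ↦ t • h(t cos θ, t sin θ)` is continuous and vanishes for `t > 0` outside `(ρ₋, ρ₊)` (`0 < ρ₋ ≤ ρ₊`), and
`ρ : [-ē, ē] → [ρ₋, ρ₊]` is C¹ with `ρ(-ē) = ρ₋`, `ρ(ē) = ρ₊` (`0 ≤ ē`), then
`∫_{t > 0} t • h(t cos θ, t sin θ) dt = ∫_{e ∈ -ē..ē} (ρ(e)·ρ'(e)) • h(ρ(e) cos θ, ρ(e) sin θ) de`. -/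
theorem klry_ray_substitution {h : ℝ × ℝ → E} (hc : Continuous h) {θ ē : ℝ} (hē : 0 ≤ ē) {ρ ρ' : ℝ → ℝ}
    (hderiv : ∀ e ∈ Icc (-ē) ē, HasDerivAt ρ (ρ' e) e) (hcont : ContinuousOn ρ' (Icc (-ē) ē))
    (hpos : 0 < ρ (-ē)) (hmono : ρ (-ē) ≤ ρ ē)
    (hsupp : ∀ t, 0 < t → t ∉ Ioo (ρ (-ē)) (ρ ē) → h (t * Real.cos θ, t * Real.sin θ) = 0) :
    ∫ t in Ioi (0 : ℝ), t • h (t * Real.cos θ, t * Real.sin θ) =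
      ∫ e in (-ē)..ē, (ρ e * ρ' e) • h (ρ e * Real.cos θ, ρ e * Real.sin θ) := by
  set g : ℝ → E := fun t => t • h (t * Real.cos θ, t * Real.sin θ) with hg
  have hgc : Continuous g := by
    refine continuous_id.smul (hc.comp ?_)
    exact (continuous_id.mul continuous_const).prodMk (continuous_id.mul continuous_const)
  -- restrict the radial integral to the segment `Ioc ρ₋ ρ₊` carrying the support
  have hsub : Ioc (ρ (-ē)) (ρ ē) ⊆ Ioi (0 : ℝ) := fun t ht => lt_trans hpos ht.1
  have hzero : ∀ t ∈ Ioi (0 : ℝ) \ Ioc (ρ (-ē)) (ρ ē), g t = 0 := by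
    intro t ht
    have ht0 : 0 < t := ht.1
    have hnot : t ∉ Ioo (ρ (-ē)) (ρ ē) := fun h' => ht.2 ⟨h'.1, h'.2.le⟩
    simp only [hg, hsupp t ht0 hnot, smul_zero]
  rw [setIntegral_eq_of_subset_of_forall_sdiff_eq_zero measurableSet_Ioi hsub hzero, ← integral_of_le hmono]
  -- substitute `t = ρ(e)`
  have huIcc : uIcc (-ē) ē = Icc (-ē) ē := uIcc_of_le (by linarith)
  have h1 := integral_deriv_smul_comp (a := -ē) (b := ē) (f := ρ) (f' := ρ') (g := g)
    (fun e he => hderiv e (huIcc ▸ he)) (huIcc ▸ hcont) hgc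
  rw [← h1]
  refine integral_congr fun e _ => ?_
  simp only [hg, Function.comp_apply, smul_smul, mul_comm (ρ' e) (ρ e)]

/-- **The planar integral in polar-ray coordinates adapted to a family of level curves.**  `h : ℝ × ℝ → E` continuous with compact support;
for every angle `θ ∈ (-π, π)` a ray reparametrisation `ρ(θ, ·)` with derivative `ρₑ(θ, ·)` on `[-ē, ē]` (`0 ≤ ē`), `ρₑ(θ, ·)` continuous there,
`0 < ρ(θ, -ē) ≤ ρ(θ, ē)`, and `h(t cos θ, t sin θ) = 0` for every `t > 0` outside `(ρ(θ,-ē), ρ(θ,ē))`.  Then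
`∫ h = ∫_{θ ∈ (-π,π)} ∫_{e ∈ -ē..ē} (ρ(θ,e)·ρₑ(θ,e)) • h(ρ(θ,e) cos θ, ρ(θ,e) sin θ) de dθ` — with `ρ(θ, ·)` the inverse of the band along the
ray, `ρ·ρₑ` is the level-set Jacobian `𝒥(θ, e)` of BGM 2006 (2.56b)–(2.56e). -/
theorem klry_integral_eq_polar_ray {h : ℝ × ℝ → E} (hc : Continuous h) (hcs : HasCompactSupport h) {ē : ℝ} (hē : 0 ≤ ē)
    {ρ ρₑ : ℝ → ℝ → ℝ}
    (hderiv : ∀ θ ∈ Ioo (-π) π, ∀ e ∈ Icc (-ē) ē, HasDerivAt (ρ θ) (ρₑ θ e) e)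
    (hcont : ∀ θ ∈ Ioo (-π) π, ContinuousOn (ρₑ θ) (Icc (-ē) ē))
    (hpos : ∀ θ ∈ Ioo (-π) π, 0 < ρ θ (-ē)) (hmono : ∀ θ ∈ Ioo (-π) π, ρ θ (-ē) ≤ ρ θ ē)
    (hsupp : ∀ θ ∈ Ioo (-π) π, ∀ t, 0 < t → t ∉ Ioo (ρ θ (-ē)) (ρ θ ē) → h (t * Real.cos θ, t * Real.sin θ) = 0) :
    ∫ p, h p = ∫ θ in Ioo (-π) π, ∫ e in (-ē)..ē, (ρ θ e * ρₑ θ e) • h (ρ θ e * Real.cos θ, ρ θ e * Real.sin θ) := by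
  rw [klry_integral_eq_integral_Ioo_integral_Ioi_polar (hc.integrable_of_hasCompactSupport hcs)]
  refine setIntegral_congr_fun measurableSet_Ioo fun θ hθ => ?_
  exact klry_ray_substitution hc hē (hderiv θ hθ) (hcont θ hθ) (hpos θ hθ) (hmono θ hθ) (hsupp θ hθ)

/-- **Radial integrands.** If moreover `h(t cos θ, t sin θ) = H θ (eOf θ t)` for `t > 0` factors through an «energy along the ray» `eOf θ`
with `eOf θ (ρ θ e) = e` on `[-ē, ē]` (i.e. `ρ(θ, ·) > 0` inverts the band along the ray), the inner integrand is `𝒥(θ,e) • H θ e`: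
`∫ h = ∫_{θ} ∫_{e ∈ -ē..ē} (ρ(θ,e)·ρₑ(θ,e)) • H θ e de dθ`. -/
theorem klry_integral_eq_polar_ray_level {h : ℝ × ℝ → E} (hc : Continuous h) (hcs : HasCompactSupport h) {ē : ℝ} (hē : 0 ≤ ē)
    {ρ ρₑ : ℝ → ℝ → ℝ} {eOf : ℝ → ℝ → ℝ} {H : ℝ → ℝ → E}
    (hderiv : ∀ θ ∈ Ioo (-π) π, ∀ e ∈ Icc (-ē) ē, HasDerivAt (ρ θ) (ρₑ θ e) e)
    (hcont : ∀ θ ∈ Ioo (-π) π, ContinuousOn (ρₑ θ) (Icc (-ē) ē))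
    (hpos : ∀ θ ∈ Ioo (-π) π, ∀ e ∈ Icc (-ē) ē, 0 < ρ θ e) (hmono : ∀ θ ∈ Ioo (-π) π, ρ θ (-ē) ≤ ρ θ ē)
    (hsupp : ∀ θ ∈ Ioo (-π) π, ∀ t, 0 < t → t ∉ Ioo (ρ θ (-ē)) (ρ θ ē) → h (t * Real.cos θ, t * Real.sin θ) = 0)
    (hfac : ∀ θ ∈ Ioo (-π) π, ∀ t, 0 < t → h (t * Real.cos θ, t * Real.sin θ) = H θ (eOf θ t))
    (hinv : ∀ θ ∈ Ioo (-π) π, ∀ e ∈ Icc (-ē) ē, eOf θ (ρ θ e) = e) :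
    ∫ p, h p = ∫ θ in Ioo (-π) π, ∫ e in (-ē)..ē, (ρ θ e * ρₑ θ e) • H θ e := by
  have hē' : -ē ∈ Icc (-ē) ē := ⟨le_rfl, by linarith⟩
  rw [klry_integral_eq_polar_ray hc hcs hē hderiv hcont (fun θ hθ => hpos θ hθ (-ē) hē') hmono hsupp]
  refine setIntegral_congr_fun measurableSet_Ioo fun θ hθ => ?_
  refine integral_congr fun e he => ?_
  have he' : e ∈ Icc (-ē) ē := by rwa [uIcc_of_le (by linarith)] at he
  simp only [hfac θ hθ (ρ θ e) (hpos θ hθ e he'), hinv θ hθ e he']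

/-! ### Bounds by integrating a ray-wise bound over the angle -/

/-- The radial integral `θ ↦ ∫_{t>0} t • h(t cos θ, t sin θ)` is integrable in the angle (Fubini). -/
theorem klry_integrableOn_ray_integral {h : ℝ × ℝ → E} (hint : Integrable h) :
    IntegrableOn (fun θ => ∫ t in Ioi (0 : ℝ), t • h (t * Real.cos θ, t * Real.sin θ)) (Ioo (-π) π) := by
  have := (integrable_polar_prod hint).swap.integral_prod_left
  simpa [IntegrableOn, Function.comp] using this

/-- **A ray-wise bound integrates to a planar bound**: if `‖∫_{t>0} t • h(t cos θ, t sin θ) dt‖ ≤ B` for every `θ ∈ (-π, π)` then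
`‖∫ h‖ ≤ 2π·B`. -/
theorem klry_norm_integral_le_of_ray_bound {h : ℝ × ℝ → E} (hint : Integrable h) {B : ℝ}
    (hB : ∀ θ ∈ Ioo (-π) π, ‖∫ t in Ioi (0 : ℝ), t • h (t * Real.cos θ, t * Real.sin θ)‖ ≤ B) :
    ‖∫ p, h p‖ ≤ 2 * π * B := by
  rw [klry_integral_eq_integral_Ioo_integral_Ioi_polar hint]
  have hvol : volume (Ioo (-π) π) < ⊤ := by rw [Real.volume_Ioo]; exact ENNReal.ofReal_lt_top
  refine (norm_setIntegral_le_of_norm_le_const hvol hB).trans (le_of_eq ?_)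
  rw [Measure.real, Real.volume_Ioo, ENNReal.toReal_ofReal (by linarith [Real.pi_pos])]
  ring

/-- **The same for a finite family summed with a scalar weight** (the shape of a Matsubara sum `β⁻¹ • Σ_i ∫ d²k h_i(k)`): if every `h_i` is
integrable and `‖c • Σ_i ∫_{t>0} t • h_i(t cos θ, t sin θ) dt‖ ≤ B` for every `θ ∈ (-π, π)`, then `‖c • Σ_i ∫ h_i‖ ≤ 2π·B` — so a
`(θ, e)`-plane estimate uniform in the angle (`klte_*`, `klsp_*` after `klry_ray_substitution`) bounds the carrier's bubble. -/
theorem klry_norm_smul_sum_integral_le_of_ray_bound {ι : Type*} [Fintype ι] {h : ι → ℝ × ℝ → E} (hint : ∀ i, Integrable (h i))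
    {c B : ℝ} (hB : ∀ θ ∈ Ioo (-π) π, ‖c • ∑ i, ∫ t in Ioi (0 : ℝ), t • h i (t * Real.cos θ, t * Real.sin θ)‖ ≤ B) :
    ‖c • ∑ i, ∫ p, h i p‖ ≤ 2 * π * B := by
  have hvol : volume (Ioo (-π) π) < ⊤ := by rw [Real.volume_Ioo]; exact ENNReal.ofReal_lt_top
  -- move everything under one angular integral
  have h1 : (c • ∑ i, ∫ p, h i p) =
      ∫ θ in Ioo (-π) π, c • ∑ i, ∫ t in Ioi (0 : ℝ), t • h i (t * Real.cos θ, t * Real.sin θ) := by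
    rw [MeasureTheory.integral_smul, integral_finsetSum _ (fun i _ => klry_integrableOn_ray_integral (hint i))]
    congr 1
    refine Finset.sum_congr rfl fun i _ => ?_
    exact klry_integral_eq_integral_Ioo_integral_Ioi_polar (hint i)
  rw [h1]
  refine (norm_setIntegral_le_of_norm_le_const hvol hB).trans (le_of_eq ?_)
  rw [Measure.real, Real.volume_Ioo, ENNReal.toReal_ofReal (by linarith [Real.pi_pos])]
  ring

end Summit.HubbardSuperconductivity.HubbardSuperconductivity.Theorems.KLRegimeSplit

end
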